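import Summits.NavierStokesRegularity.NavierStokesRegularity.Theorems.SymmetricScarExists.Negative.OneGoodSliceKinematicMember
import Summits.NavierStokesRegularity.NavierStokesRegularity.Theorems.RellichScarSymmetricScarExistsPeriodicWorld

/-!
# Crux `SymmetricScarExists` (stmt-NavierStokesRegularity-11718), line `logtime-bernoulli-certificate`:
# the momentum equation is LOAD-BEARING for every form of the bet

Refuter's negative lemma, part 2 of 2 (drefute gen 3; `--supports stmt-NavierStokesRegularity-11718`;
theorems only, no definitions, no named facts).

The three registered bet stubs of `Cruxes/SymmetricScarExists/Lines/logtime-bernoulli-certificate.lean`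
(`stub_oneGoodSlice` 4′ ⇐ `stub_finiteGaussianAction` 4 ⇐ `stub_logtimeBernoulliCertificate` 3) quantify
over the weighted class
`LB(C, K) = {(U, P) : IsBackwardLeraySolutionOn univ 1 U P ∧ the eight weighted bounds}`, and
`IsBackwardLeraySolutionOn` is the conjunction of FOUR fields: joint smoothness of `U`, joint smoothness
of `P`, the Leray momentum equation, `div U = 0`.  With the momentum equation deleted (the other three
fields and all eight bounds kept) the explicit `2π`-periodic profile of part 1
(`exists_kinematic_member`, `P = 0`) shows:

* `oneGoodSlice_false_without_momentum`: the statement of `stub_oneGoodSlice` (4′) so weakened is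
  FALSE (`δ = 1/2`, `R = 2`: every slice has a point of `B₂` with `‖∂ₛU‖ > 1/2`);
* `finiteGaussianAction_false_without_momentum`: the statement of `stub_finiteGaussianAction` (4) so
  weakened is FALSE (the Gaussian action over `n` periods is `n` times a positive constant — the lead's
  `intervalIntegral_period_pos_of_periodic`, `not_exists_bound_intervalIntegral_of_periodic`).

Reading for the line: any proof of 4′ (hence of 4, 3) must use the Leray momentum equation — the eight
scale-invariant bounds, smoothness and incompressibility carry no selection principle (they admit
periodic orbits); and the bounds half of `LB(C, K)` is satisfiable by a NON-ZERO smooth divergence-free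
field, so the interface minus dynamics is not secretly degenerate.  Complements the CONDITIONAL
periodic-world kills (`…PeriodicWorld.lean` p73845, `Negative/OneGoodSlicePeriodicWorld.lean` p82511),
whose periodic member must solve the momentum equation and is a `λ`-DSS blow-up profile (open).
No `sorry`.
-/

noncomputable section

open Set Metric Function Filter MeasureTheory Topology
open scoped ContDiff

namespace Summit.NavierStokesRegularity.NavierStokesRegularity.Theorems.SymmetricScarExists.Negative

set_option linter.dupNamespace false

open Literature.Analysis.FluidPDE Literature.Analysis.FluidPDE.PineauVicol2026
open Summit.NavierStokesRegularity.NavierStokesRegularity.Theorems.SymmetricScarExists.LogtimeBernoulli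


/-! ### The kinematic class: `LB(C, K)` with the momentum equation deleted -/

/-- **The kinematic class is inhabited by a periodic profile with no good slice.**  Packaging of
`exists_kinematic_member` in the exact shape of the line's hypothesis block with
`IsBackwardLeraySolutionOn univ 1 U P` replaced by its three non-dynamical fields (joint smoothness of
`U` and `P`, `div U = 0`) and `P = 0`. [folklore] -/
theorem exists_kinematic_member_LB :
    ∃ (C K : ℝ) (U : ℝ → EuclideanSpace ℝ (Fin 3) → EuclideanSpace ℝ (Fin 3)) (P : ℝ → EuclideanSpace ℝ (Fin 3) → ℝ),
      ((Literature.Analysis.FluidPDE.IsSmoothSpaceTimeOn (Set.univ : Set ℝ) U ∧ Literature.Analysis.FluidPDE.IsSmoothSpaceTimeOn (Set.univ : Set ℝ) P ∧ ∀ s : ℝ, Literature.Analysis.FluidPDE.VectorCalculus.IsDivFree (U s)) ∧ ∀ (s : ℝ) (y : EuclideanSpace ℝ (Fin 3)), (1 + ‖y‖) * ‖U s y‖ ≤ C ∧ (1 + ‖y‖) ^ 2 * ‖fderiv ℝ (U s) y‖ ≤ K ∧ (1 + ‖y‖) ^ 3 * ‖iteratedFDeriv ℝ 2 (U s) y‖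 ≤ K ∧ (1 + ‖y‖) ^ 2 * |P s y| ≤ K ∧ (1 + ‖y‖) ^ 3 * ‖gradient (P s) y‖ ≤ K ∧ (1 + ‖y‖) * ‖Literature.Analysis.FluidPDE.timeDerivWithin (Set.univ : Set ℝ) U s y‖ ≤ K ∧ (1 + ‖y‖) ^ 2 * ‖fderiv ℝ (fun z => Literature.Analysis.FluidPDE.timeDerivWithin (Set.univ : Set ℝ) U s z) y‖ ≤ K ∧ (1 + ‖y‖) ^ 3 * ‖Literature.Analysis.FluidPDE.timeDerivWithin (Set.univ : Set ℝ) U s y + (1 / 2 : ℝ) • U s y + (1 / 2 : ℝ) • fderiv ℝ (U s) y y‖ ≤ K) ∧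
      (∀ s y, U (s + 2 * Real.pi) y = U s y) ∧ (∀ s y, P (s + 2 * Real.pi) y = P s y) ∧
      (∀ s y, ‖timeDerivWithin (univ : Set ℝ) U s y‖ ≤ K) ∧
      (∀ s, ∃ y : EuclideanSpace ℝ (Fin 3), ‖y‖ < 2 ∧
        (1 / 2 : ℝ) < ‖timeDerivWithin (univ : Set ℝ) U s y‖) := by
  obtain ⟨U, hUsm, hdiv, ⟨C, K, hK0, hbd⟩, hper, hbad⟩ := exists_kinematic_member
  refine ⟨C, K, U, fun _ _ => 0, ⟨⟨hUsm, contDiffOn_const, hdiv⟩, fun s y => ?_⟩, hper,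
    fun _ _ => rfl, fun s y => ?_, hbad⟩
  · obtain ⟨b1, b2, b3, b6, b7, b8⟩ := hbd s y
    refine ⟨b1, b2, b3, ?_, ?_, b6, b7, b8⟩
    · rw [abs_zero, mul_zero]; exact hK0
    · rw [gradient_fun_const, norm_zero, mul_zero]; exact hK0
  · have h := (hbd s y).2.2.2.1
    have h1 : ‖timeDerivWithin (univ : Set ℝ) U s y‖ ≤
        (1 + ‖y‖) * ‖timeDerivWithin (univ : Set ℝ) U s y‖ :=
      le_mul_of_one_le_left (norm_nonneg _) (by linarith [norm_nonneg y])
    exact h1.trans h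

/-- **`stub_oneGoodSlice` is FALSE without the momentum equation** (load-bearing hypothesis): the
registered statement of the weakest bet 4′ with `IsBackwardLeraySolutionOn univ 1 U P` weakened to
its three kinematic fields admits the explicit periodic counterexample of `exists_kinematic_member`
(take `δ = 1/2`, `R = 2`).  Any proof of 4′ — hence of 4 and 3 — must use the Leray dynamics. [folklore] -/
theorem oneGoodSlice_false_without_momentum :
    ¬ (∀ (C K : ℝ) (U : ℝ → EuclideanSpace ℝ (Fin 3) → EuclideanSpace ℝ (Fin 3)) (P : ℝ → EuclideanSpace ℝ (Fin 3) → ℝ), ((Literature.Analysis.FluidPDE.IsSmoothSpaceTimeOn (Set.univ : Set ℝ) U ∧ Literature.Analysis.FluidPDE.IsSmoothSpaceTimeOn (Set.univ : Set ℝ) P ∧ ∀ s : ℝ, Literature.Analysis.FluidPDE.VectorCalculus.IsDivFree (U s)) ∧ ∀ (s : ℝ) (y : EuclideanSpace ℝ (Fin 3)), (1 + ‖y‖) * ‖U s y‖ ≤ C ∧ (1 + ‖y‖) ^ 2 * ‖fderiv ℝ (U s) y‖ ≤ K ∧ (1 + ‖y‖) ^ 3 * ‖iteratedFDeriv ℝ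 2 (U s) y‖ ≤ K ∧ (1 + ‖y‖) ^ 2 * |P s y| ≤ K ∧ (1 + ‖y‖) ^ 3 * ‖gradient (P s) y‖ ≤ K ∧ (1 + ‖y‖) * ‖Literature.Analysis.FluidPDE.timeDerivWithin (Set.univ : Set ℝ) U s y‖ ≤ K ∧ (1 + ‖y‖) ^ 2 * ‖fderiv ℝ (fun z => Literature.Analysis.FluidPDE.timeDerivWithin (Set.univ : Set ℝ) U s z) y‖ ≤ K ∧ (1 + ‖y‖) ^ 3 * ‖Literature.Analysis.FluidPDE.timeDerivWithin (Set.univ : Set ℝ) U s y + (1 / 2 : ℝ) • U s y + (1 / 2 : ℝ) • fderiv ℝ (U s) y y‖ ≤ K) → ∀ δ : ℝ, 0 < δ → ∀ R : ℝ, 0 < R → (∃ sbar : ℝ, ∀ y : EuclideanSpace ℝ (Fin 3), ‖y‖ < R → ‖Literature.Analysis.FluidPDE.timeDerivWithin (Set.univ : Set ℝ) U sbar y‖ ≤ δ)) := by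
  intro h
  obtain ⟨C, K, U, P, hLB, -, -, -, hbad⟩ := exists_kinematic_member_LB
  obtain ⟨sbar, hsbar⟩ := h C K U P hLB (1 / 2) (by norm_num) 2 (by norm_num)
  obtain ⟨y, hy, hbig⟩ := hbad sbar
  exact absurd (hsbar y hy) (not_le.2 hbig)

/-- **`stub_finiteGaussianAction` is FALSE without the momentum equation**: for the same periodic
kinematic profile the Gaussian action `∫_{s₁}^{s₂}∫‖∂ₛU‖² g` over `n` periods is `n` times a positive
constant (the lead's periodic-action lemmas `intervalIntegral_period_pos_of_periodic`,
`not_exists_bound_intervalIntegral_of_periodic`), so no bound `A` exists. [folklore] -/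
theorem finiteGaussianAction_false_without_momentum :
    ¬ (∀ (C K : ℝ) (U : ℝ → EuclideanSpace ℝ (Fin 3) → EuclideanSpace ℝ (Fin 3)) (P : ℝ → EuclideanSpace ℝ (Fin 3) → ℝ), ((Literature.Analysis.FluidPDE.IsSmoothSpaceTimeOn (Set.univ : Set ℝ) U ∧ Literature.Analysis.FluidPDE.IsSmoothSpaceTimeOn (Set.univ : Set ℝ) P ∧ ∀ s : ℝ, Literature.Analysis.FluidPDE.VectorCalculus.IsDivFree (U s)) ∧ ∀ (s : ℝ) (y : EuclideanSpace ℝ (Fin 3)), (1 + ‖y‖) * ‖U s y‖ ≤ C ∧ (1 + ‖y‖) ^ 2 * ‖fderiv ℝ (U s) y‖ ≤ K ∧ (1 + ‖y‖) ^ 3 * ‖iteratedFDeriv ℝ 2 (U s) y‖ ≤ K ∧ (1 + ‖y‖) ^ 2 * |P s y| ≤ K ∧ (1 + ‖y‖) ^ 3 * ‖gradient (P s) y‖ ≤ K ∧ (1 + ‖y‖) * ‖Literature.Analysis.FluidPDE.timeDerivWithin (Set.univ : Set ℝ) U s y‖ ≤ K ∧ (1 + ‖y‖) ^ 2 * ‖fderiv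 ℝ (fun z => Literature.Analysis.FluidPDE.timeDerivWithin (Set.univ : Set ℝ) U s z) y‖ ≤ K ∧ (1 + ‖y‖) ^ 3 * ‖Literature.Analysis.FluidPDE.timeDerivWithin (Set.univ : Set ℝ) U s y + (1 / 2 : ℝ) • U s y + (1 / 2 : ℝ) • fderiv ℝ (U s) y y‖ ≤ K) → (∃ A : ℝ, ∀ s₁ s₂ : ℝ, s₁ ≤ s₂ → (∫ σ in s₁..s₂, (∫ y : EuclideanSpace ℝ (Fin 3), ‖Literature.Analysis.FluidPDE.timeDerivWithin (Set.univ : Set ℝ) U σ y‖ ^ 2 * Literature.Analysis.FluidPDE.PineauVicol2026.gaussWeight y)) ≤ A)) := by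
  intro h
  obtain ⟨C, K, U, P, hLB, hper, -, hbdK, hbad⟩ := exists_kinematic_member_LB
  obtain ⟨A, hA⟩ := h C K U P hLB
  -- the defect is jointly continuous and bounded by `K`
  have hV : IsSmoothSpaceTimeOn (univ : Set ℝ) (timeDerivWithin (univ : Set ℝ) U) :=
    hLB.1.1.timeDerivWithin uniqueDiffOn_univ
  have hc : Continuous (uncurry (timeDerivWithin (univ : Set ℝ) U)) := by
    have := hV.continuousOn
    rwa [univ_prod_univ, continuousOn_univ] at this
  have hFc := continuous_integral_norm_sq_mul_gaussWeight hc hbdK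
  -- the action density is `2π`-periodic, nonnegative, positive at `s = 0`
  have hFper : Periodic (fun σ => ∫ y : EuclideanSpace ℝ (Fin 3),
      ‖timeDerivWithin (univ : Set ℝ) U σ y‖ ^ 2 * gaussWeight y) (2 * Real.pi) := fun σ => by
    simp only [timeDerivWithin_univ_periodic hper]
  have hF0 : ∀ σ, 0 ≤ ∫ y : EuclideanSpace ℝ (Fin 3),
      ‖timeDerivWithin (univ : Set ℝ) U σ y‖ ^ 2 * gaussWeight y := fun σ =>
    integral_nonneg fun y => mul_nonneg (sq_nonneg _) (gaussWeight_pos y).le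
  obtain ⟨y₀, -, hy₀⟩ := hbad 0
  have hne : timeDerivWithin (univ : Set ℝ) U 0 y₀ ≠ 0 := fun h0 => by
    rw [h0, norm_zero] at hy₀
    linarith
  have hFs₀ : 0 < ∫ y : EuclideanSpace ℝ (Fin 3),
      ‖timeDerivWithin (univ : Set ℝ) U 0 y‖ ^ 2 * gaussWeight y :=
    integral_norm_sq_mul_gaussWeight_pos (hc.comp (continuous_const.prodMk continuous_id))
      (hbdK 0) hne
  have hIpos := intervalIntegral_period_pos_of_periodic hFc hF0 Real.two_pi_pos hFper hFs₀
  exact not_exists_bound_intervalIntegral_of_periodic Real.two_pi_pos hFper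
    (fun a b => hFc.intervalIntegrable a b) hIpos ⟨A, hA⟩

end Summit.NavierStokesRegularity.NavierStokesRegularity.Theorems.SymmetricScarExists.Negative

end
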